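import Mathlib
import Literature.MathematicalPhysics.QuantumFieldTheory.OSReconstructionNoE1Proofs
import Summits.QuantumFields.YangMills.Theorems.MirrorModularBoostsPlanarSpectralConeDensityHelpers
import HarnessLib

/-!
# Stub `stub_density_of_parts` — density of cone-chain vectors from the gap lemmas

Line `positivity-disc-to-operator-cone` of crux `MirrorModularBoosts.PlanarSpectralCone`
(stmt-QuantumFields-9664), second lead. With the statements of `stub_oneGap` (one-gap holomorphic
stretching) and `stub_windowedDensity` (windowed tensor products are Schwartz-dense among time-ordered
test functions) as hypotheses, the field vectors of strict cone chains span a dense subspace of the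
`e₀`-OS space. Proof: for `χ` orthogonal to all cone-chain vectors,
(i) windowed tensor products all of whose pairs of windows are *wide* (`bᵢ + 2ρ < aⱼ`, `i < j`) are
internally cone-ordered with `|x¹| ≤ ρ`, so `χ ⊥ Ψ` by first-gap absorption
(`Density.inner_fieldVec_eq_zero_of_internallyConed`);
(ii) induction over the number `J` of leading unconstrained windows: split `⊗ fᵢ = P ⊗ Q` after the
first `J + 1` factors, stretch the gap by `s ≥ 2ρ` (all pairs from `J` on become wide), and come back
to `s = 0` with the one-gap hypothesis;
(iii) closure: `G ↦ Ψ_G` is linear and continuous on time-ordered test functions, so windowed density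
gives `χ ⊥ Ψ_F` for every time-ordered `F`, and the `Ψ_F` are total.
-/

noncomputable section

namespace Summit.QuantumFields.YangMills.Cruxes.PlanarSpectralCone.PositivityDiscToOperatorCone

open MeasureTheory
open scoped InnerProductSpace SchwartzMap
open Literature.MathematicalPhysics.QuantumLattice Literature.MathematicalPhysics.AQFT
  Literature.MathematicalPhysics.QuantumFieldTheory

/-- Euclidean `ℝ⁴`, time = coordinate `0`, the boost plane = coordinates `0, 1`. -/
local notation "E4" => EuclideanSpace ℝ (Fin 4)

namespace Density

/-! ## Windowed tensor products -/

/-- A windowed tensor product is time-ordered: the windows `[aᵢ, bᵢ]` are positive and ordered. -/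
theorem isTimeOrdered_tensorFin_windowed {n : ℕ} {f : Fin n → 𝓢(EuclideanSpace ℝ (Fin 4), ℂ)}
    {a b : Fin n → ℝ} {ρ : ℝ} (ha : ∀ i, 0 < a i) (hab : ∀ i j, i < j → b i < a j)
    (hf : ∀ i, tsupport (f i : EuclideanSpace ℝ (Fin 4) → ℂ) ⊆
      {x | a i ≤ x 0 ∧ x 0 ≤ b i ∧ |x 1| ≤ ρ}) :
    IsTimeOrdered (SchwartzMap.tensorFin n f) := by
  intro x hx
  have hw := fun i => hf i (apply_mem_tsupport_of_mem_tsupport_tensorFin f hx i)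
  refine ⟨fun i => (ha i).trans_le (hw i).1, fun i j hij => ?_⟩
  have h1 := hab i j hij
  have h2 := (hw i).2.1
  have h3 := (hw j).1
  show x i 0 < x j 0
  linarith

/-- **All pairs wide ⇒ orthogonal** (base of the induction): a windowed tensor product with
`bᵢ + 2ρ < aⱼ` for all `i < j` is internally cone-ordered with `|x¹| ≤ ρ`, so first-gap absorption
applies. -/
theorem inner_tensorFin_eq_zero_of_allWide
    (S : SchwingerFamily (EuclideanSpace ℝ (Fin 4))) (h : OSReconstructionNoE1 S.toLabelled)
    (χ : h.Hilbert)
    (hχ : ∀ (m : ℕ) (G : 𝓢((Fin m → EuclideanSpace ℝ (Fin 4)), ℂ)) (hG : IsTimeOrdered G),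
      tsupport (G : (Fin m → EuclideanSpace ℝ (Fin 4)) → ℂ) ⊆
        {x | (∀ i, |x i 1| < x i 0) ∧ ∀ i j, i < j → |x j 1 - x i 1| < x j 0 - x i 0} →
      ⟪χ, h.fieldVec m (fun _ => ()) G hG⟫_ℂ = 0)
    {n : ℕ} {f : Fin n → 𝓢(EuclideanSpace ℝ (Fin 4), ℂ)} {a b : Fin n → ℝ} {ρ : ℝ}
    (hf : ∀ i, tsupport (f i : EuclideanSpace ℝ (Fin 4) → ℂ) ⊆
      {x | a i ≤ x 0 ∧ x 0 ≤ b i ∧ |x 1| ≤ ρ})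
    (hwide : ∀ i j, i < j → b i + 2 * ρ < a j) (hG : IsTimeOrdered (SchwartzMap.tensorFin n f)) :
    ⟪χ, h.fieldVec n (fun _ => ()) (SchwartzMap.tensorFin n f) hG⟫_ℂ = 0 := by
  refine inner_fieldVec_eq_zero_of_internallyConed S h χ hχ _ hG ρ fun x hx => ?_
  have hw := fun i => hf i (apply_mem_tsupport_of_mem_tsupport_tensorFin f hx i)
  refine ⟨fun i => (hw i).2.2, fun i j hij => ?_⟩
  have h1 : |x j 1 - x i 1| ≤ |x j 1| + |x i 1| := abs_sub _ _
  have h2 := (hw i).2.2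
  have h3 := (hw j).2.2
  have h4 := hwide i j hij
  have h5 := (hw i).2.1
  have h6 := (hw j).1
  show |x j 1 - x i 1| < x j 0 - x i 0
  linarith

/-- **Stretched windows.** Appending to the first `J + 1` windows the last `l + 1` windows shifted by
`s ≥ max (2ρ) 0` gives windowed data again, now with all pairs from index `J` on wide, provided the
original pairs from index `J + 1` on were wide. -/
theorem windows_append_shift {J l : ℕ} {a b : Fin ((J + 1) + (l + 1)) → ℝ} {ρ s : ℝ}
    (ha : ∀ i, 0 < a i) (hab : ∀ i j, i < j → b i < a j)
    (hwide : ∀ i j : Fin ((J + 1) + (l + 1)), i < j → J + 1 ≤ i.val → b i + 2 * ρ < a j)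
    (h2ρ : 2 * ρ ≤ s) (hs0 : 0 ≤ s) :
    (∀ i, 0 < (Fin.append (fun i => a (Fin.castAdd (l + 1) i))
        (fun j => a (Fin.natAdd (J + 1) j) + s) i : ℝ)) ∧
    (∀ i j, i < j →
      (Fin.append (fun i => b (Fin.castAdd (l + 1) i)) (fun j => b (Fin.natAdd (J + 1) j) + s) i : ℝ) <
        Fin.append (fun i => a (Fin.castAdd (l + 1) i)) (fun j => a (Fin.natAdd (J + 1) j) + s) j) ∧
    (∀ i j : Fin ((J + 1) + (l + 1)), i < j → J ≤ i.val →
      (Fin.append (fun i => b (Fin.castAdd (l + 1) i)) (fun j => b (Fin.natAdd (J + 1) j) + s) i : ℝ) +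
          2 * ρ <
        Fin.append (fun i => a (Fin.castAdd (l + 1) i)) (fun j => a (Fin.natAdd (J + 1) j) + s) j) := by
  refine ⟨fun i => ?_, fun i j hij => ?_, fun i j hij hJ => ?_⟩
  · induction i using Fin.addCases with
    | left i => simpa only [Fin.append_left] using ha _
    | right j => simpa only [Fin.append_right] using add_pos_of_pos_of_nonneg (ha _) hs0
  · induction i using Fin.addCases with
    | left i =>
      induction j using Fin.addCases with
      | left j => simpa only [Fin.append_left] using hab _ _ hij
      | right j =>
        simp only [Fin.append_left, Fin.append_right]
        exact lt_add_of_lt_of_nonneg (hab _ _ hij) hs0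
    | right i =>
      induction j using Fin.addCases with
      | left j =>
        exfalso
        rw [Fin.lt_def, Fin.val_natAdd, Fin.val_castAdd] at hij
        omega
      | right j =>
        simp only [Fin.append_right]
        linarith [hab _ _ hij]
  · induction i using Fin.addCases with
    | left i =>
      induction j using Fin.addCases with
      | left j =>
        exfalso
        rw [Fin.lt_def, Fin.val_castAdd, Fin.val_castAdd] at hij
        rw [Fin.val_castAdd] at hJ
        omega
      | right j =>
        simp only [Fin.append_left, Fin.append_right]
        linarith [hab _ _ hij]
    | right i =>
      induction j using Fin.addCases with
      | left j =>
        exfalso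
        rw [Fin.lt_def, Fin.val_natAdd, Fin.val_castAdd] at hij
        omega
      | right j =>
        simp only [Fin.append_right]
        have := hwide _ _ hij (by rw [Fin.val_natAdd]; omega)
        linarith

/-- **Stretched factors.** The factors `f ∘ castAdd ++ (f ∘ natAdd)_{s e₀}` are supported in the
stretched windows. -/
theorem tsupport_append_shift {J l : ℕ} {f : Fin ((J + 1) + (l + 1)) → 𝓢(EuclideanSpace ℝ (Fin 4), ℂ)}
    {a b : Fin ((J + 1) + (l + 1)) → ℝ} {ρ : ℝ}
    (hf : ∀ i, tsupport (f i : EuclideanSpace ℝ (Fin 4) → ℂ) ⊆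
      {x | a i ≤ x 0 ∧ x 0 ≤ b i ∧ |x 1| ≤ ρ}) (s : ℝ)
    (i : Fin ((J + 1) + (l + 1))) :
    tsupport ((Fin.append (fun i => f (Fin.castAdd (l + 1) i))
        (fun j => translateTest (SchwingerFamily.timeVec s) (f (Fin.natAdd (J + 1) j))) i :
          𝓢(EuclideanSpace ℝ (Fin 4), ℂ)) : EuclideanSpace ℝ (Fin 4) → ℂ) ⊆
      {x | Fin.append (fun i => a (Fin.castAdd (l + 1) i)) (fun j => a (Fin.natAdd (J + 1) j) + s) i ≤
          x 0 ∧
        x 0 ≤ Fin.append (fun i => b (Fin.castAdd (l + 1) i)) (fun j => b (Fin.natAdd (J + 1) j) + s) i ∧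
        |x 1| ≤ ρ} := by
  induction i using Fin.addCases with
  | left i => simpa only [Fin.append_left] using hf _
  | right j =>
    simp only [Fin.append_right]
    intro x hx
    have hx' := hf _ (tsupport_translateTest_subset _ _ hx)
    simp only [Set.mem_setOf_eq, PiLp.sub_apply, PiLp.single_apply, one_ne_zero, ↓reduceIte,
      sub_zero] at hx'
    refine ⟨?_, ?_, hx'.2.2⟩ <;> linarith [hx'.1, hx'.2.1]

/-- **Levels of the split.** For windowed data on `(J + 1) + (l + 1)` points, the first `J + 1`
factors live at times `< T` and the last `l + 1` at times `> T`, `T` the midpoint of gap `J`. -/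
theorem levels_of_windowed {J l : ℕ} {f : Fin ((J + 1) + (l + 1)) → 𝓢(EuclideanSpace ℝ (Fin 4), ℂ)}
    {a b : Fin ((J + 1) + (l + 1)) → ℝ} {ρ : ℝ} (hab : ∀ i j, i < j → b i < a j)
    (hf : ∀ i, tsupport (f i : EuclideanSpace ℝ (Fin 4) → ℂ) ⊆
      {x | a i ≤ x 0 ∧ x 0 ≤ b i ∧ |x 1| ≤ ρ}) :
    tsupport ((SchwartzMap.tensorFin (J + 1) fun i => f (Fin.castAdd (l + 1) i) :
        𝓢((Fin (J + 1) → EuclideanSpace ℝ (Fin 4)), ℂ)) : (Fin (J + 1) → EuclideanSpace ℝ (Fin 4)) → ℂ) ⊆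
      {x | ∀ i, x i 0 <
        (b (Fin.castAdd (l + 1) (Fin.last J)) + a (Fin.natAdd (J + 1) 0)) / 2} ∧
    tsupport ((SchwartzMap.tensorFin (l + 1) fun j => f (Fin.natAdd (J + 1) j) :
        𝓢((Fin (l + 1) → EuclideanSpace ℝ (Fin 4)), ℂ)) : (Fin (l + 1) → EuclideanSpace ℝ (Fin 4)) → ℂ) ⊆
      {x | ∀ j, (b (Fin.castAdd (l + 1) (Fin.last J)) + a (Fin.natAdd (J + 1) 0)) / 2 < x j 0} := by
  have hgap : b (Fin.castAdd (l + 1) (Fin.last J)) < a (Fin.natAdd (J + 1) 0) :=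
    hab _ _ (by rw [Fin.lt_def, Fin.val_castAdd, Fin.val_natAdd, Fin.val_last]; omega)
  refine ⟨fun x hx i => ?_, fun x hx j => ?_⟩
  · have hw := fun i => hf _ (apply_mem_tsupport_of_mem_tsupport_tensorFin _ hx i)
    have hlast : x (Fin.last J) 0 ≤ b (Fin.castAdd (l + 1) (Fin.last J)) := (hw (Fin.last J)).2.1
    rcases (Fin.le_last i).lt_or_eq with hi | rfl
    · have h1 : b (Fin.castAdd (l + 1) i) < a (Fin.castAdd (l + 1) (Fin.last J)) :=
        hab _ _ (by rw [Fin.lt_def, Fin.val_castAdd, Fin.val_castAdd]; exact hi)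
      have h2 := (hw i).2.1
      have h3 := (hw (Fin.last J)).1
      show x i 0 < _
      linarith
    · show x (Fin.last J) 0 < _
      linarith
  · have hw := fun j => hf _ (apply_mem_tsupport_of_mem_tsupport_tensorFin _ hx j)
    have hfirst : a (Fin.natAdd (J + 1) 0) ≤ x 0 0 := (hw 0).1
    by_cases hj : j = 0
    · subst hj
      show _ < x 0 0
      linarith
    · have hj' : (0 : Fin (l + 1)) < j := Fin.pos_iff_ne_zero.2 hj
      have h1 : b (Fin.natAdd (J + 1) 0) < a (Fin.natAdd (J + 1) j) :=
        hab _ _ (by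
          rw [Fin.lt_def, Fin.val_natAdd, Fin.val_natAdd]
          have := Fin.lt_def.1 hj'
          omega)
      have h2 := (hw 0).2.1
      have h3 := (hw j).1
      show _ < x j 0
      linarith

/-- **Induction over the leading gaps.** If `χ` is orthogonal to all cone-chain vectors and the
one-gap stretching principle holds, then for every `J`: `χ ⊥ Ψ_{⊗ fᵢ}` for all windowed data whose
pairs of windows from index `J` on are wide. -/
theorem inner_tensorFin_eq_zero_of_wideFrom
    (S : SchwingerFamily (EuclideanSpace ℝ (Fin 4))) (h : OSReconstructionNoE1 S.toLabelled)
    (h_oneGap : ∀ {k l : ℕ} (P : 𝓢((Fin k → EuclideanSpace ℝ (Fin 4)), ℂ))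
      (Q : 𝓢((Fin l → EuclideanSpace ℝ (Fin 4)), ℂ)) (T : ℝ),
      IsTimeOrdered P → IsTimeOrdered Q →
      tsupport (P : (Fin k → EuclideanSpace ℝ (Fin 4)) → ℂ) ⊆ {x | ∀ i, x i 0 < T} →
      tsupport (Q : (Fin l → EuclideanSpace ℝ (Fin 4)) → ℂ) ⊆ {x | ∀ i, T < x i 0} →
      ∀ (χ : h.Hilbert) (s₀ : ℝ),
      (∀ s : ℝ, s₀ ≤ s → 0 ≤ s →
        ∀ hs : IsTimeOrdered (P.appendTensor (translateMulti (SchwingerFamily.timeVec s) Q)),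
          ⟪χ, h.fieldVec (k + l) (fun _ => ()) _ hs⟫_ℂ = 0) →
      ∀ (s : ℝ), 0 ≤ s →
        ∀ hs : IsTimeOrdered (P.appendTensor (translateMulti (SchwingerFamily.timeVec s) Q)),
          ⟪χ, h.fieldVec (k + l) (fun _ => ()) _ hs⟫_ℂ = 0)
    (χ : h.Hilbert)
    (hχ : ∀ (m : ℕ) (G : 𝓢((Fin m → EuclideanSpace ℝ (Fin 4)), ℂ)) (hG : IsTimeOrdered G),
      tsupport (G : (Fin m → EuclideanSpace ℝ (Fin 4)) → ℂ) ⊆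
        {x | (∀ i, |x i 1| < x i 0) ∧ ∀ i j, i < j → |x j 1 - x i 1| < x j 0 - x i 0} →
      ⟪χ, h.fieldVec m (fun _ => ()) G hG⟫_ℂ = 0)
    (J : ℕ) :
    ∀ (n : ℕ) (f : Fin n → 𝓢(EuclideanSpace ℝ (Fin 4), ℂ)) (a b : Fin n → ℝ) (ρ : ℝ),
      (∀ i, 0 < a i) → (∀ i j, i < j → b i < a j) →
      (∀ i, tsupport (f i : EuclideanSpace ℝ (Fin 4) → ℂ) ⊆ {x | a i ≤ x 0 ∧ x 0 ≤ b i ∧ |x 1| ≤ ρ}) →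
      (∀ i j : Fin n, i < j → J ≤ i.val → b i + 2 * ρ < a j) →
      ∀ hG : IsTimeOrdered (SchwartzMap.tensorFin n f),
        ⟪χ, h.fieldVec n (fun _ => ()) (SchwartzMap.tensorFin n f) hG⟫_ℂ = 0 := by
  induction J with
  | zero =>
    intro n f a b ρ _ _ hf hwide hG
    exact inner_tensorFin_eq_zero_of_allWide S h χ hχ hf (fun i j hij => hwide i j hij (Nat.zero_le _))
      hG
  | succ J ih =>
    intro n f a b ρ ha hab hf hwide hG
    rcases le_or_gt n (J + 1) with hle | hlt
    · exact ih n f a b ρ ha hab hf (fun i j hij hJ => by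
        have h1 := j.isLt
        have h2 : (i : ℕ) < j := hij
        omega) hG
    obtain ⟨l, rfl⟩ : ∃ l, n = (J + 1) + (l + 1) := by
      obtain ⟨l, hl⟩ := Nat.exists_eq_add_of_lt hlt
      exact ⟨l, by omega⟩
    -- the split `⊗ f = P ⊗ Q` after the first `J + 1` factors
    set P : 𝓢((Fin (J + 1) → EuclideanSpace ℝ (Fin 4)), ℂ) :=
      SchwartzMap.tensorFin (J + 1) fun i => f (Fin.castAdd (l + 1) i) with hP_def
    set Q : 𝓢((Fin (l + 1) → EuclideanSpace ℝ (Fin 4)), ℂ) :=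
      SchwartzMap.tensorFin (l + 1) fun j => f (Fin.natAdd (J + 1) j) with hQ_def
    have hP : IsTimeOrdered P :=
      isTimeOrdered_tensorFin_windowed (fun i => ha _)
        (fun i j hij => hab (Fin.castAdd (l + 1) i) (Fin.castAdd (l + 1) j) hij) fun i => hf _
    have hQ : IsTimeOrdered Q :=
      isTimeOrdered_tensorFin_windowed (fun j => ha _)
        (fun i j hij => hab (Fin.natAdd (J + 1) i) (Fin.natAdd (J + 1) j)
          (Nat.add_lt_add_left (Fin.lt_def.1 hij) (J + 1))) fun j => hf _
    obtain ⟨hPT, hQT⟩ := levels_of_windowed (f := f) hab hf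
    -- the stretched products are tensor products of stretched windowed data
    have hid : ∀ s : ℝ, P.appendTensor (translateMulti (SchwingerFamily.timeVec s) Q) =
        SchwartzMap.tensorFin ((J + 1) + (l + 1)) (Fin.append (fun i => f (Fin.castAdd (l + 1) i))
          fun j => translateTest (SchwingerFamily.timeVec s) (f (Fin.natAdd (J + 1) j))) :=
      fun s => appendTensor_translateMulti_tensorFin _ _ _
    have hfar : ∀ s : ℝ, 2 * ρ ≤ s → 0 ≤ s →
        ∀ hs : IsTimeOrdered (P.appendTensor (translateMulti (SchwingerFamily.timeVec s) Q)),
          ⟪χ, h.fieldVec ((J + 1) + (l + 1)) (fun _ => ()) _ hs⟫_ℂ = 0 := by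
      intro s h2ρ hs0 hs
      have hs' : IsTimeOrdered (SchwartzMap.tensorFin ((J + 1) + (l + 1))
          (Fin.append (fun i => f (Fin.castAdd (l + 1) i))
            fun j => translateTest (SchwingerFamily.timeVec s) (f (Fin.natAdd (J + 1) j)))) := by
        rw [← hid s]; exact hs
      rw [fieldVec_congr h (hid s) hs hs']
      obtain ⟨ha', hab', hwide'⟩ := windows_append_shift (l := l) ha hab hwide h2ρ hs0
      exact ih _ _ _ _ ρ ha' hab' (tsupport_append_shift hf s) hwide' hs'
    -- back to `s = 0` by the one-gap principle
    have hid0 : P.appendTensor (translateMulti (SchwingerFamily.timeVec 0) Q) =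
        SchwartzMap.tensorFin ((J + 1) + (l + 1)) f := by
      rw [SchwingerFamily.timeVec_zero, translateMulti_zero, hP_def, hQ_def, ← tensorFin_add]
    have hs0 : IsTimeOrdered (P.appendTensor (translateMulti (SchwingerFamily.timeVec 0) Q)) := by
      rw [hid0]; exact hG
    have h0 := h_oneGap P Q _ hP hQ hPT hQT χ (2 * ρ) hfar 0 le_rfl hs0
    rwa [fieldVec_congr h hid0 hs0 hG] at h0

/-! ## Closure -/

/-- **The span of the windowed tensor products**: every element is time-ordered and, if `χ` is
orthogonal to all windowed tensor products, orthogonal to `χ`. -/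
theorem inner_eq_zero_of_mem_span_windowed
    (S : SchwingerFamily (EuclideanSpace ℝ (Fin 4))) (h : OSReconstructionNoE1 S.toLabelled)
    (χ : h.Hilbert) {n : ℕ}
    (hW : ∀ (f : Fin n → 𝓢(EuclideanSpace ℝ (Fin 4), ℂ)) (a b : Fin n → ℝ) (ρ : ℝ),
      (∀ i, 0 < a i) → (∀ i j, i < j → b i < a j) →
      (∀ i, tsupport (f i : EuclideanSpace ℝ (Fin 4) → ℂ) ⊆ {x | a i ≤ x 0 ∧ x 0 ≤ b i ∧ |x 1| ≤ ρ}) →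
      ∀ hG : IsTimeOrdered (SchwartzMap.tensorFin n f),
        ⟪χ, h.fieldVec n (fun _ => ()) (SchwartzMap.tensorFin n f) hG⟫_ℂ = 0)
    {G : 𝓢((Fin n → EuclideanSpace ℝ (Fin 4)), ℂ)}
    (hGW : G ∈ (Submodule.span ℂ
      {G : 𝓢((Fin n → EuclideanSpace ℝ (Fin 4)), ℂ) |
        ∃ (f : Fin n → 𝓢(EuclideanSpace ℝ (Fin 4), ℂ)) (a b : Fin n → ℝ) (ρ : ℝ),
        (∀ i, 0 < a i) ∧ (∀ i j, i < j → b i < a j) ∧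
        (∀ i, tsupport (f i : EuclideanSpace ℝ (Fin 4) → ℂ) ⊆ {x | a i ≤ x 0 ∧ x 0 ≤ b i ∧ |x 1| ≤ ρ}) ∧
        IsTensorOf G f} : Submodule ℂ 𝓢((Fin n → EuclideanSpace ℝ (Fin 4)), ℂ))) :
    IsTimeOrdered G ∧ ∀ hG : IsTimeOrdered G, ⟪χ, h.fieldVec n (fun _ => ()) G hG⟫_ℂ = 0 := by
  induction hGW using Submodule.span_induction with
  | mem G hG =>
    obtain ⟨f, a, b, ρ, ha, hab, hf, hGf⟩ := hG
    obtain rfl : G = SchwartzMap.tensorFin n f := hGf.unique (isTensorOf_tensorFin f)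
    exact ⟨isTimeOrdered_tensorFin_windowed ha hab hf, hW f a b ρ ha hab hf⟩
  | zero =>
    refine ⟨fun x hx => ?_, fun h0 => by rw [fieldVec_zero h h0, inner_zero_right]⟩
    rw [FunLike.coe_zero, tsupport_zero] at hx
    exact absurd hx (Set.notMem_empty x)
  | add F G _ _ hF hG =>
    refine ⟨isTimeOrdered_add hF.1 hG.1, fun hFG => ?_⟩
    rw [fieldVec_add h hF.1 hG.1 hFG, inner_add_right, hF.2, hG.2, add_zero]
  | smul c F _ hF =>
    refine ⟨OSReconstructionNoE1.isTimeOrdered_smul c hF.1, fun hcF => ?_⟩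
    rw [fieldVec_smul h c hF.1 hcF, inner_smul_right, hF.2, mul_zero]

end Density

open Density in
/-- **Stub 3c — DENSITY FROM THE GAP LEMMAS (arrow form: one-gap lemma + windowed density ⇒
density of cone-chain vectors).** With the statements of `stub_oneGap` and `stub_windowedDensity` as
HYPOTHESES (verbatim), the cone-chain field vectors span a dense subspace of the `e₀`-OS space:
a vector `χ` orthogonal to the span is orthogonal to every cone-chain vector, hence
(`Density.inner_tensorFin_eq_zero_of_wideFrom`: first-gap absorption + induction over the gaps) to
every windowed tensor product, hence (`Density.inner_eq_zero_of_mem_span_windowed`, `h_wd`,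
continuity of `G ↦ Ψ_G` along time-ordered families) to `Ψ_F` for every time-ordered `F`, hence zero
(totality of field vectors). `hlg`, `hsym` are idle. -/
theorem stub_density_of_parts
    (h_oneGap : ∀ (S : SchwingerFamily E4) (h : OSReconstructionNoE1 S.toLabelled)
      {k l : ℕ} (P : 𝓢((Fin k → E4), ℂ)) (Q : 𝓢((Fin l → E4), ℂ)) (T : ℝ),
      IsTimeOrdered P → IsTimeOrdered Q →
      tsupport (P : (Fin k → E4) → ℂ) ⊆ {x | ∀ i, x i 0 < T} →
      tsupport (Q : (Fin l → E4) → ℂ) ⊆ {x | ∀ i, T < x i 0} →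
      ∀ (χ : h.Hilbert) (s₀ : ℝ),
      (∀ s : ℝ, s₀ ≤ s → 0 ≤ s →
        ∀ hs : IsTimeOrdered (P.appendTensor (translateMulti (SchwingerFamily.timeVec s) Q)),
          ⟪χ, h.fieldVec (k + l) (fun _ => ()) _ hs⟫_ℂ = 0) →
      ∀ (s : ℝ), 0 ≤ s →
        ∀ hs : IsTimeOrdered (P.appendTensor (translateMulti (SchwingerFamily.timeVec s) Q)),
          ⟪χ, h.fieldVec (k + l) (fun _ => ()) _ hs⟫_ℂ = 0)
    (h_wd : ∀ {n : ℕ} (F : 𝓢((Fin n → E4), ℂ)), IsTimeOrdered F →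
      F ∈ closure ((Submodule.span ℂ
        {G : 𝓢((Fin n → E4), ℂ) | ∃ (f : Fin n → 𝓢(E4, ℂ)) (a b : Fin n → ℝ) (ρ : ℝ),
          (∀ i, 0 < a i) ∧ (∀ i j, i < j → b i < a j) ∧
          (∀ i, tsupport (f i : E4 → ℂ) ⊆ {x | a i ≤ x 0 ∧ x 0 ≤ b i ∧ |x 1| ≤ ρ}) ∧
          IsTensorOf G f} : Submodule ℂ 𝓢((Fin n → E4), ℂ)) : Set 𝓢((Fin n → E4), ℂ)))
    (S : SchwingerFamily E4) (_hlg : S.toLabelled.HasLinearGrowth)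
    (_hsym : S.toLabelled.IsSymmetric) (h : OSReconstructionNoE1 S.toLabelled) :
    Dense ((Submodule.span ℂ
      {ψ : h.Hilbert | ∃ (m : ℕ) (G : 𝓢((Fin m → E4), ℂ)) (hG : IsTimeOrdered G),
        tsupport (G : (Fin m → E4) → ℂ) ⊆
          {x | (∀ i, |x i 1| < x i 0) ∧ ∀ i j, i < j → |x j 1 - x i 1| < x j 0 - x i 0} ∧
        ψ = h.fieldVec m (fun _ => ()) G hG} : Submodule ℂ h.Hilbert) : Set h.Hilbert) := by
  rw [Submodule.dense_iff_topologicalClosure_eq_top, Submodule.topologicalClosure_eq_top_iff,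
    Submodule.eq_bot_iff]
  intro χ hχ
  -- `χ` is orthogonal to every cone-chain vector
  have hχ' : ∀ (m : ℕ) (G : 𝓢((Fin m → EuclideanSpace ℝ (Fin 4)), ℂ)) (hG : IsTimeOrdered G),
      tsupport (G : (Fin m → EuclideanSpace ℝ (Fin 4)) → ℂ) ⊆
        {x | (∀ i, |x i 1| < x i 0) ∧ ∀ i j, i < j → |x j 1 - x i 1| < x j 0 - x i 0} →
      ⟪χ, h.fieldVec m (fun _ => ()) G hG⟫_ℂ = 0 := by
    intro m G hG hC
    have hk : h.fieldVec m (fun _ => ()) G hG ∈ Submodule.span ℂ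
        {ψ : h.Hilbert | ∃ (m : ℕ) (G : 𝓢((Fin m → EuclideanSpace ℝ (Fin 4)), ℂ))
          (hG : IsTimeOrdered G),
          tsupport (G : (Fin m → EuclideanSpace ℝ (Fin 4)) → ℂ) ⊆
            {x | (∀ i, |x i 1| < x i 0) ∧ ∀ i j, i < j → |x j 1 - x i 1| < x j 0 - x i 0} ∧
          ψ = h.fieldVec m (fun _ => ()) G hG} :=
      Submodule.subset_span ⟨m, G, hG, hC, rfl⟩
    rw [← inner_conj_symm, Submodule.inner_right_of_mem_orthogonal hk hχ, map_zero]
  -- hence to `Ψ_F` for every time-ordered `F` (windowed products, their span, its closure)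
  refine eq_zero_of_forall_inner_fieldVec_eq_zero h χ fun n F hF => ?_
  obtain ⟨u, huW, hu⟩ := mem_closure_iff_seq_limit.1 (h_wd F hF)
  have hP := fun j => inner_eq_zero_of_mem_span_windowed S h χ
    (fun f a b ρ ha hab hf hG => inner_tensorFin_eq_zero_of_wideFrom S h
      (fun P Q T => h_oneGap S h P Q T) χ hχ' n n f a b ρ ha hab hf
      (fun i j hij hJ => by
        have h1 := i.isLt
        omega) hG) (huW j)
  exact inner_fieldVec_eq_zero_of_tendsto h χ (fun j => (hP j).1) hF hu fun j => (hP j).2 _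

end Summit.QuantumFields.YangMills.Cruxes.PlanarSpectralCone.PositivityDiscToOperatorCone
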